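import Summits.RiemannHypothesis.RiemannHypothesis.Theorems.ZetaScrewTopSecondDifference
import HarnessLib

/-!
# RH-FREE: the second-order cusp expansion of Suzuki's screw function `Ψ = zetaScrew` at `0⁺`

Continues `ZetaScrewCuspExpansion.lean` one order further: for `0 < t ≤ 1/2`,

  `|Ψ(t) − ((t/2)·log(1/t) + c·t + (7/8)·t²)| ≤ t³/3`,  `c = (1 − γ₀ − log 2π)/2`  (`abs_zetaScrew_sub_cusp₂_le`),

the `t²`-coefficient `7/8` being IDENTIFIED (`1` from the archimedean `4(e^{t/2}+e^{−t/2}−2)`, `−1/8` from the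
Hurwitz–Lerch piece).  Method: the tree's closed form of `Ψ″` on `(0, ∞)`
(`IntegerScrewPsiDeriv.hasDerivAt_zetaScrewDeriv`, `Ψ″ = e^{t/2} + e^{−t/2} − w/(2(1−w²)) − w/(2(1+w²))`,
`w = e^{−t/2}`) satisfies `0 ≤ Ψ″(t) + 1/(2t) − 7/4 ≤ t/3` on `(0, 1/2]` (`zetaScrewDeriv2_add_sub_mem`;
three elementary pieces: `0 ≤ e^{t/2}+e^{−t/2}−2 ≤ t²/2`, `0 ≤ 1/(2t) − 1/(2(e^{t/2}−e^{−t/2})) ≤ t/36` from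
`t ≤ e^{t/2} − e^{−t/2} ≤ t + t³/18`, and `0 ≤ 1/4 − w/(2(1+w²)) = (1−w)²/(4(1+w²)) ≤ t²/16`); a mean-value step
on `[s, t]` plus `s → 0⁺` through the first-order derivative remainder (`≤ 6s`, `ZetaScrewCuspExpansion`) gives
`|Ψ′(t) − ((1/2)log(1/t) − 1/2 + c + (7/4)t)| ≤ t²/3` (`abs_zetaScrewDeriv_sub_cuspDeriv₂_le`), and a second
mean-value step on `[0, t]` (`Ψ(0) = 0`) the `t³/3` remainder.  Used by `ZetaScrewTopSecondDifferenceDrift`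
(the `1/M` drift of `M·Δ²Ψ_top`).

RH-FREE: statements about the explicit archimedean part of Suzuki2023 (1.1) near `0`; nothing here bears on
the truth of RH.  References: M. Suzuki, J. Lond. Math. Soc. (2) 108 (2023) [Suzuki2023]; [folklore].
-/

set_option linter.dupNamespace false
set_option autoImplicit false

noncomputable section

open Real Set

namespace Summit.RiemannHypothesis.RiemannHypothesis.Theorems.IntegerScrew

open Literature.NumberTheory.LFunctions

/-! ## The second derivative near `0`: `0 ≤ Ψ″(t) + 1/(2t) − 7/4 ≤ t/3` -/

/-- `t ≤ e^{t/2} − e^{−t/2} ≤ t + t³/18` for `0 ≤ t ≤ 1` (`2 sinh(t/2)`, cubic Taylor bounds). [folklore] -/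
theorem exp_half_sub_exp_neg_half_mem {t : ℝ} (ht : 0 ≤ t) (ht1 : t ≤ 1) :
    t ≤ Real.exp (t / 2) - Real.exp (-(t / 2))
      ∧ Real.exp (t / 2) - Real.exp (-(t / 2)) ≤ t + t ^ 3 / 18 := by
  constructor
  · have h : t / 2 ≤ Real.sinh (t / 2) := Real.self_le_sinh_iff.mpr (by linarith)
    rw [Real.sinh_eq] at h
    linarith
  · have h1 : |t / 2| ≤ 1 := by rw [abs_of_nonneg (by linarith)]; linarith
    have h2 : |(-(t / 2))| ≤ 1 := by rw [abs_neg]; exact h1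
    have e1 := Real.exp_bound h1 (n := 3) (by norm_num)
    have e2 := Real.exp_bound h2 (n := 3) (by norm_num)
    simp only [Finset.sum_range_succ, Finset.sum_range_zero, Nat.factorial] at e1 e2
    norm_num at e1 e2
    have hh : (0 : ℝ) ≤ t / 2 := by linarith
    rw [abs_of_nonneg hh] at e1 e2
    have u1 := (abs_le.mp e1).2
    have u2 := (abs_le.mp e2).1
    nlinarith [u1, u2]

set_option maxHeartbeats 400000 in
/-- **The second derivative remainder.** For `0 < t ≤ 1/2`,
`0 ≤ Ψ″(t) + 1/(2t) − 7/4 ≤ t/3` (`Ψ″ = zetaScrewDeriv2`). [folklore] -/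
theorem zetaScrewDeriv2_add_sub_mem {t : ℝ} (ht : 0 < t) (ht2 : t ≤ 1 / 2) :
    0 ≤ zetaScrewDeriv2 t + 1 / (2 * t) - 7 / 4
      ∧ zetaScrewDeriv2 t + 1 / (2 * t) - 7 / 4 ≤ t / 3 := by
  set w := Real.exp (-(t / 2)) with hw
  set W := Real.exp (t / 2) with hW
  have hw0 : 0 < w := Real.exp_pos _
  have hW0 : 0 < W := Real.exp_pos _
  have hwW : w * W = 1 := by rw [hw, hW, ← Real.exp_add]; simp
  have hw1 : w < 1 := by rw [hw, Real.exp_lt_one_iff]; linarith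
  have hwt : 1 - t / 2 ≤ w := by have := Real.add_one_le_exp (-(t / 2)); linarith
  obtain ⟨hD1, hD2⟩ := exp_half_sub_exp_neg_half_mem ht.le (by linarith)
  have hD0 : 0 < W - w := by linarith
  -- piece 1: `0 ≤ W + w − 2 ≤ t²/2`
  have hP1 : 0 ≤ W + w - 2 ∧ W + w - 2 ≤ t ^ 2 / 2 := by
    have h1 : |t / 2| ≤ 1 := by rw [abs_of_pos (by linarith)]; linarith
    have h2 : |(-(t / 2))| ≤ 1 := by rw [abs_neg]; exact h1
    have e1 := abs_le.mp (Real.abs_exp_sub_one_sub_id_le h1)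
    have e2 := abs_le.mp (Real.abs_exp_sub_one_sub_id_le h2)
    constructor
    · -- AM-GM: `W + w ≥ 2√(Ww) = 2`
      nlinarith [sq_nonneg (W - w), hwW]
    · nlinarith [e1.2, e2.2]
  -- piece 2: `w/(2(1−w²)) = 1/(2(W−w))` and `0 ≤ 1/(2t) − 1/(2(W−w)) ≤ t/36`
  have hT2 : w / (2 * (1 - w ^ 2)) = 1 / (2 * (W - w)) := by
    have h1w2 : (1 : ℝ) - w ^ 2 ≠ 0 := by nlinarith
    rw [div_eq_div_iff (by positivity) (by positivity)]
    linear_combination (2 : ℝ) * hwW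
  have hP2 : 0 ≤ 1 / (2 * t) - 1 / (2 * (W - w)) ∧ 1 / (2 * t) - 1 / (2 * (W - w)) ≤ t / 36 := by
    have e1 : 1 / (2 * t) - 1 / (2 * (W - w)) = (W - w - t) / (2 * t * (W - w)) := by
      field_simp
    rw [e1]
    constructor
    · exact div_nonneg (by linarith) (by positivity)
    · rw [div_le_iff₀ (by positivity)]
      -- `W − w − t ≤ t³/18 ≤ (t/36)·2t·(W−w)` since `W − w ≥ t`
      have h3 : t ^ 3 / 18 ≤ t / 36 * (2 * t * (W - w)) := by
        have e2 : t / 36 * (2 * t * (W - w)) = t ^ 2 * (W - w) / 18 := by ring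
        rw [e2]
        have : t ^ 3 ≤ t ^ 2 * (W - w) := by nlinarith [sq_nonneg t]
        linarith
      linarith
  -- piece 3: `0 ≤ 1/4 − w/(2(1+w²)) ≤ t²/16`
  have hP3 : 0 ≤ 1 / 4 - w / (2 * (1 + w ^ 2)) ∧ 1 / 4 - w / (2 * (1 + w ^ 2)) ≤ t ^ 2 / 16 := by
    have e1 : 1 / 4 - w / (2 * (1 + w ^ 2)) = (1 - w) ^ 2 / (4 * (1 + w ^ 2)) := by
      field_simp
      ring
    rw [e1]
    constructor
    · positivity
    · rw [div_le_iff₀ (by positivity)]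
      have h1 : (1 - w) ^ 2 ≤ (t / 2) ^ 2 := pow_le_pow_left₀ (by linarith) (by linarith) 2
      nlinarith [sq_nonneg w, sq_nonneg t]
  -- assemble
  have key : zetaScrewDeriv2 t + 1 / (2 * t) - 7 / 4
      = (W + w - 2) + (1 / (2 * t) - 1 / (2 * (W - w))) + (1 / 4 - w / (2 * (1 + w ^ 2))) := by
    simp only [zetaScrewDeriv2, ← hw, ← hW]
    rw [hT2]
    ring
  rw [key]
  constructor
  · linarith [hP1.1, hP2.1, hP3.1]
  · nlinarith [hP1.2, hP2.2, hP3.2]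

/-! ## The first-derivative remainder is `O(t²)` -/

/-- For `0 < t ≤ 1/2`: `|Ψ′(t) − ((1/2)log(1/t) − 1/2 + c + (7/4)t)| ≤ t²/3`.  Mean value theorem on
`[s, t]` with `Ψ″`, and `s → 0⁺` through the first-order bound `≤ 6s + (7/4)s`. [folklore] -/
theorem abs_zetaScrewDeriv_sub_cuspDeriv₂_le {t : ℝ} (ht : 0 < t) (ht2 : t ≤ 1 / 2) :
    |zetaScrewDeriv t - (1 / 2 * Real.log (1 / t) - 1 / 2
        + (1 - Real.eulerMascheroniConstant - Real.log (2 * Real.pi)) / 2 + 7 / 4 * t)| ≤ t ^ 2 / 3 := by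
  set c := (1 - Real.eulerMascheroniConstant - Real.log (2 * Real.pi)) / 2 with hc
  set E : ℝ → ℝ := fun y => zetaScrewDeriv y - (1 / 2 * Real.log (1 / y) - 1 / 2 + c + 7 / 4 * y)
    with hE
  set F : ℝ → ℝ := fun y => zetaScrewDeriv2 y + 1 / (2 * y) - 7 / 4 with hF
  -- derivative of `E` on `(0, ∞)`
  have hEderiv : ∀ y : ℝ, 0 < y → HasDerivAt E (F y) y := by
    intro y hy
    have h1 := hasDerivAt_zetaScrewDeriv hy
    have h2 : HasDerivAt (fun y : ℝ => 1 / 2 * Real.log (1 / y) - 1 / 2 + c + 7 / 4 * y)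
        (-(1 / (2 * y)) + 7 / 4) y := by
      have hl := Real.hasDerivAt_log hy.ne'
      have h := (((hl.const_mul (-(1 / 2))).sub_const (1 / 2)).add_const c).add
        ((hasDerivAt_id y).const_mul (7 / 4))
      have e : (fun y : ℝ => 1 / 2 * Real.log (1 / y) - 1 / 2 + c + 7 / 4 * y)
          = fun y => -(1 / 2) * Real.log y - 1 / 2 + c + 7 / 4 * id y := by
        funext y; simp only [one_div, Real.log_inv, id]; ring
      rw [e]
      refine h.congr_deriv ?_
      simp only [mul_one]; field_simp
    have h := h1.sub h2
    refine h.congr_deriv ?_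
    simp only [hF]; ring
  -- first-order bound from `ZetaScrewCuspExpansion`: `|E s| ≤ 8 s`
  have hE8 : ∀ s : ℝ, 0 < s → s ≤ 1 / 2 → |E s| ≤ 8 * s := by
    intro s hs hs2
    have h1 := abs_zetaScrewDeriv_sub_cuspDeriv_le hs hs2
    have e : E s = (zetaScrewDeriv s - (1 / 2 * Real.log (1 / s) - 1 / 2 + c)) - 7 / 4 * s := by
      simp only [hE]; ring
    rw [e]
    have h2 := abs_sub (zetaScrewDeriv s - (1 / 2 * Real.log (1 / s) - 1 / 2 + c)) (7 / 4 * s)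
    rw [abs_of_pos (by positivity : (0 : ℝ) < 7 / 4 * s)] at h2
    linarith
  -- MVT on `[s, t]` for every `0 < s < t`
  have hst : ∀ s : ℝ, 0 < s → s < t → |E t| ≤ t ^ 2 / 3 + 8 * s := by
    intro s hs hst
    have hcont : ContinuousOn E (Icc s t) := fun y hy =>
      (hEderiv y (lt_of_lt_of_le hs hy.1)).continuousAt.continuousWithinAt
    have hder : ∀ y ∈ Ioo s t, HasDerivAt E (F y) y := fun y hy => hEderiv y (lt_trans hs hy.1)
    obtain ⟨ξ, hξ, hslope⟩ := exists_hasDerivAt_eq_slope E F hst hcont hder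
    have hξ0 : 0 < ξ := lt_trans hs hξ.1
    obtain ⟨hF0, hF1⟩ := zetaScrewDeriv2_add_sub_mem hξ0 (by linarith [hξ.2])
    have hts : 0 < t - s := by linarith
    rw [eq_div_iff hts.ne'] at hslope
    -- `E t − E s = F ξ (t − s)` with `0 ≤ F ξ ≤ ξ/3 ≤ t/3`
    have h1 : |E t - E s| ≤ t / 3 * (t - s) := by
      rw [← hslope, abs_of_nonneg (mul_nonneg hF0 hts.le)]
      exact mul_le_mul_of_nonneg_right (by linarith [hξ.2]) hts.le
    have h2 := hE8 s hs (by linarith)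
    have h3 := abs_sub_abs_le_abs_sub (E t) (E s)
    nlinarith [abs_nonneg (E s)]
  -- `s → 0⁺`
  refine le_of_forall_pos_le_add fun ε hε => ?_
  have hs0 : 0 < min (t / 2) (ε / 8) := lt_min (by linarith) (by linarith)
  have h := hst (min (t / 2) (ε / 8)) hs0 (lt_of_le_of_lt (min_le_left _ _) (by linarith))
  have h8 : 8 * min (t / 2) (ε / 8) ≤ ε := by
    have := min_le_right (t / 2) (ε / 8); linarith
  linarith

/-! ## The second-order cusp expansion of `Ψ` -/

/-- **Second-order cusp expansion (RH-free, identified coefficients).** For `0 < t ≤ 1/2`,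
`|Ψ(t) − ((t/2)log(1/t) + c·t + (7/8)t²)| ≤ t³/3`, `c = (1 − γ₀ − log 2π)/2`. [folklore] -/
theorem abs_zetaScrew_sub_cusp₂_le {t : ℝ} (ht : 0 < t) (ht2 : t ≤ 1 / 2) :
    |zetaScrew t - (t / 2 * Real.log (1 / t)
        + (1 - Real.eulerMascheroniConstant - Real.log (2 * Real.pi)) / 2 * t + 7 / 8 * t ^ 2)|
      ≤ t ^ 3 / 3 := by
  set c := (1 - Real.eulerMascheroniConstant - Real.log (2 * Real.pi)) / 2 with hc
  set R : ℝ → ℝ := fun y => zetaScrew y - (y / 2 * Real.log (1 / y) + c * y + 7 / 8 * y ^ 2) with hR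
  set E : ℝ → ℝ := fun y => zetaScrewDeriv y - (1 / 2 * Real.log (1 / y) - 1 / 2 + c + 7 / 4 * y)
    with hE
  have hlog2 : (1 : ℝ) / 2 < Real.log 2 := by
    have := Real.log_two_gt_d9; norm_num at this ⊢; linarith
  have hm : Continuous fun y : ℝ => y / 2 * Real.log (1 / y) + c * y + 7 / 8 * y ^ 2 := by
    have e : (fun y : ℝ => y / 2 * Real.log (1 / y) + c * y + 7 / 8 * y ^ 2)
        = fun y => -(1 / 2) * (y * Real.log y) + c * y + 7 / 8 * y ^ 2 := by
      funext y; rw [one_div, Real.log_inv]; ring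
    rw [e]
    exact ((continuous_const.mul Real.continuous_mul_log).add (continuous_const.mul continuous_id)).add
      (continuous_const.mul (continuous_pow 2))
  have hRcont : ContinuousOn R (Icc 0 t) := (continuous_zetaScrew.sub hm).continuousOn
  have hRderiv : ∀ y ∈ Ioo 0 t, HasDerivAt R (E y) y := by
    intro y hy
    have hy0 : 0 < y := hy.1
    have hy2 : y < Real.log 2 := by linarith [hy.2]
    have h1 := hasDerivAt_zetaScrew hy0 hy2
    have h2 : HasDerivAt (fun y : ℝ => y / 2 * Real.log (1 / y) + c * y + 7 / 8 * y ^ 2)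
        (1 / 2 * Real.log (1 / y) - 1 / 2 + c + 7 / 4 * y) y := by
      have hml := Real.hasDerivAt_mul_log hy0.ne'
      have h := ((hml.const_mul (-(1 / 2))).add ((hasDerivAt_id y).const_mul c)).add
        ((hasDerivAt_pow 2 y).const_mul (7 / 8))
      have e : (fun y : ℝ => y / 2 * Real.log (1 / y) + c * y + 7 / 8 * y ^ 2)
          = fun y => -(1 / 2) * (y * Real.log y) + c * id y + 7 / 8 * y ^ 2 := by
        funext y; rw [one_div, Real.log_inv]; simp only [id]; ring
      rw [e]
      refine h.congr_deriv ?_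
      simp only [one_div, Real.log_inv, mul_one]
      push_cast
      ring
    exact h1.sub h2
  obtain ⟨ξ, hξ, hslope⟩ := exists_hasDerivAt_eq_slope R E ht hRcont hRderiv
  have hR0 : R 0 = 0 := by simp [hR, zetaScrew_zero]
  rw [hR0, sub_zero, sub_zero, eq_div_iff ht.ne'] at hslope
  have hEξ : |E ξ| ≤ ξ ^ 2 / 3 := abs_zetaScrewDeriv_sub_cuspDeriv₂_le hξ.1 (by linarith [hξ.2])
  have hRt : R t = E ξ * t := hslope.symm
  have hξt : ξ ^ 2 ≤ t ^ 2 := pow_le_pow_left₀ hξ.1.le hξ.2.le 2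
  show |R t| ≤ t ^ 3 / 3
  calc |R t| = |E ξ| * t := by rw [hRt, abs_mul, abs_of_pos ht]
    _ ≤ ξ ^ 2 / 3 * t := by gcongr
    _ ≤ t ^ 3 / 3 := by nlinarith [hξt]

end Summit.RiemannHypothesis.RiemannHypothesis.Theorems.IntegerScrew

end
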